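import Summits.FinalStateConjecture.FinalStateConjecture.Theorems.SeamedChartsExhaust.Negative.ReversedFlatChart

/-!
# The future-orientation clause of `HonestCore` is load-bearing for `SeamedChartsExhaust`
# (negative-side support for crux `stmt-FinalStateConjecture-13551`, route `StarvedNecks`)

The crux `SeamedChartsExhaust` (`Theses/StarvedNecks.lean`) asserts, for every `C²` final-state
decomposition `d` of the self-determined exterior `O = J⁺(ι X) ∩ I⁻(d.charted)` of an MGHD, that
`HonestCore(d, R₀)` (clauses (a)–(d)) and `SEAMED(d, R, R₀)` (clauses (1)–(12)) imply
`Summit.FinalStateConjecture.HasExhaustiveCharts d`. Its proof consumes the time direction of the flat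
chart only through `HonestCore` (d) ("`dΦ(e₀)` is future-directed causal at flat-late points"). Here:
(d) cannot simply be dropped from the spacetime-level form of the statement
(`not_forall_hasExhaustiveCharts_without_futureOrientation`): with `HonestCore` (a)–(c) and ALL twelve
SEAMED clauses kept verbatim and `O = J⁺(Σ) ∩ I⁻(d.charted)` for an arbitrary set `Σ`, exhaustion fails
for the time-reversed flat chart on Minkowski spacetime (`ReversedFlatChart.lean`: `Σ = ℝ⁴`,
`O = {x⁰ < 0}`, `N = 0`, flat chart `x ↦ (−x⁰, x̲)` after `τ₀ = 0`, `τ₁ = 1`, `p = (−1/2, 0)`).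

Scope note. In the route's own setting `Σ = ι(X)` is a Cauchy hypersurface and SEAMED (3) makes `dΦ(e₀)`
timelike on the connected flat-late region, which excludes a GLOBALLY reversed flat chart (its `e₀`-lines
would be past-directed timelike curves of unbounded length inside `J⁺(Σ)`); the model shows exactly that
the argument needs SOME clause fixing the time direction of the flat chart, and (d) is that clause. The
dropped-clause statement is inlined (no named fact is introduced); everything is `sorry`-free.

References: B. O'Neill, *Semi-Riemannian geometry*, Academic Press 1983, Ch. 14, p. 402; M. Dafermos,
G. Holzegel, I. Rodnianski, M. Taylor, arXiv:2104.08222, §1.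
-/

noncomputable section

open TopologicalSpace Manifold Filter Topology Set Function
open scoped ContDiff Topology ENNReal Manifold

namespace Summit.FinalStateConjecture.FinalStateConjecture.Theorems.SeamedChartsExhaust.Negative

open Literature.Geometry.Lorentzian LorentzianMetric


/-- **`HonestCore` (d) is load-bearing.** The spacetime-level form of `StarvedNecks.SeamedChartsExhaust`
with the future-orientation clause (d) of the flat chart DELETED — hypotheses, in order: the shape
`O = J⁺(Σ) ∩ I⁻(d.charted)`; `HonestCore` (a) sub-extremal holes, `100 Mᵢ ≤ R₀`, orthochronous boosts;
(b) anchoring; (c) relative closedness; SEAMED (1)–(12) verbatim — does NOT imply `HasExhaustiveCharts d`: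
the time-reversed flat chart on Minkowski spacetime (`ReversedModel.decomp`) satisfies all of them and
violates exhaustion at `τ₁ = 1`. O'Neill 1983, Ch. 14, p. 402. [folklore] -/
theorem not_forall_hasExhaustiveCharts_without_futureOrientation :
    ¬ ∀ (𝓢 : Spacetime.{0} 4) (S₀ O : Set 𝓢.carrier) (d : FinalStateDecomposition 𝓢 O 2)
        (R : Fin d.N → ℝ → ℝ) (R₀ : ℝ),
      O = 𝓢.metric.causalFuture 𝓢.timeOrientation S₀ ∩
        𝓢.metric.chronologicalPast 𝓢.timeOrientation d.charted →
      -- HonestCore (a)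
      (∀ i, Kerr.IsSubextremal (d.mass i) (d.spin i) ∧ 100 * d.mass i ≤ R₀ ∧
        0 < ((d.motion i).1 : E4 ≃L[ℝ] E4) (E4.basisVector 0) 0) →
      -- HonestCore (b): anchoring
      (∀ i (ϱ τ₂ : ℝ), R₀ ≤ ϱ → d.τ₀ < τ₂ →
        d.chart i '' {x | d.τ₀ < (d.background i).time x.1 ∧ (d.background i).time x.1 < τ₂ ∧
            (d.background i).radius x.1 < ϱ} ⊆
          𝓢.metric.causalPast 𝓢.timeOrientation (d.chart i '' (d.background i).truncTimeSlab ϱ τ₂)) →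
      -- HonestCore (c): relative closedness
      (∀ i (τ' : ℝ) (ϱ : ℝ → ℝ), Continuous ϱ → d.τ₀ < τ' →
        closure (d.chart i '' {x | τ' ≤ (d.background i).time x.1 ∧
            (d.background i).radius x.1 ≤ ϱ ((d.background i).time x.1)}) ∩ O ⊆
          d.chart i '' {x | τ' ≤ (d.background i).time x.1 ∧
            (d.background i).radius x.1 ≤ ϱ ((d.background i).time x.1)}) →
      -- SEAMED (1)
      (∀ i, Monotone (R i) ∧ Continuous (R i) ∧ ∀ s, R₀ + 4 ≤ R i s ∧ R₀ ≤ d.excision i s) →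
      -- SEAMED (2)
      (∀ i, Tendsto (fun τ ↦ 𝓢.truncDeviationCk (d.background i) (d.chart i) 2 (R i τ) τ) atTop (𝓝 0)) →
      -- SEAMED (3)
      supCkENorm (Subtype.val '' {y : d.flatDomain | d.τ₀ ≤ y.1 0}) 0
          (𝓢.deviationExtend (Minkowski.backgroundOn d.flatDomain) d.flatChart) ≤ 10⁻¹ →
      -- SEAMED (4)
      (∀ i, supCkENorm (Subtype.val '' {x : (d.background i).domain |
          (d.τ₀ ≤ (d.background i).time x.1 ∨ d.τ₀ ≤ x.1 0) ∧ R₀ ≤ (d.background i).radius x.1 ∧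
            (d.background i).radius x.1 ≤ R i ((d.background i).time x.1)}) 0
          (𝓢.deviationExtend (d.background i) (d.chart i)) ≤
          ENNReal.ofReal (1 / (10 * ‖(((d.motion i).1 : E4 ≃L[ℝ] E4) : E4 →L[ℝ] E4)‖ ^ 2))) →
      -- SEAMED (5)
      (∀ i (x : (d.background i).domain), (d.τ₀ ≤ (d.background i).time x.1 ∨ d.τ₀ ≤ x.1 0) →
        R₀ ≤ (d.background i).radius x.1 → (d.background i).radius x.1 ≤ R i ((d.background i).time x.1) →
        𝓢.timeOrientation.IsFutureDirected
          (mfderiv 𝓘(ℝ, E4) (𝓡 4) (d.chart i) x (((d.motion i).1 : E4 ≃L[ℝ] E4) (E4.basisVector 0)))) →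
      -- SEAMED (6): one atlas
      (∀ i (y : E4) (hy : y ∈ (d.background i).domain), d.τ₀ ≤ y 0 →
        (∀ j, d.excision j (y 0) < (d.background j).radius y) →
        (d.background i).radius y ≤ R i ((d.background i).time y) + 1 →
        ∃ hy' : y ∈ d.flatDomain, d.chart i ⟨y, hy⟩ = d.flatChart ⟨y, hy'⟩) →
      -- SEAMED (7)
      (∀ y : d.flatDomain, d.τ₀ ≤ y.1 0 → ∀ j, d.excision j (y.1 0) < (d.background j).radius y.1) →
      -- SEAMED (8)
      (∀ j (y : E4), d.τ₀ ≤ y 0 → (d.background j).radius y ≤ d.excision j (y 0) →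
        (d.background j).radius y + 2 ≤ R j ((d.background j).time y)) →
      -- SEAMED (9)
      (∀ j (y : E4), d.τ₀ ≤ (d.background j).time y →
        (d.background j).radius y ≤ R j ((d.background j).time y) + 2 → (d.background j).time y ≤ y 0) →
      -- SEAMED (10)
      (∀ j, d.chart j '' {x | d.τ₀ < (d.background j).time x.1 ∧
          R j ((d.background j).time x.1) + 1 < (d.background j).radius x.1} ⊆ d.radiationZone) →
      -- SEAMED (11)
      (∀ τ' : ℝ, d.τ₀ < τ' → closure (d.flatChart '' {y | τ' ≤ y.1 0}) ⊆
        d.flatChart '' {y | τ' ≤ y.1 0} ∪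
          ⋃ j, d.chart j '' {x | τ' ≤ x.1 0 ∧ (d.background j).radius x.1 = d.excision j (x.1 0)}) →
      -- SEAMED (12)
      (∀ j j' (y : E4), j ≠ j' → (d.τ₀ ≤ y 0 ∨ d.τ₀ ≤ (d.background j).time y) →
        (d.background j).radius y ≤ R j ((d.background j).time y) + 1 →
        R j' ((d.background j').time y) + 1 < (d.background j').radius y) →
      HasExhaustiveCharts d := by
  intro h
  refine ReversedModel.not_hasExhaustiveCharts_decomp
    (h Minkowski.spacetime univ ReversedModel.O ReversedModel.decomp Fin.elim0 0 ReversedModel.O_eq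
      (fun i ↦ i.elim0) (fun i ↦ i.elim0) (fun i ↦ i.elim0) (fun i ↦ i.elim0) (fun i ↦ i.elim0) ?_
      (fun i ↦ i.elim0) (fun i ↦ i.elim0) (fun i ↦ i.elim0) (fun _ _ j ↦ j.elim0) (fun j ↦ j.elim0)
      (fun j ↦ j.elim0) (fun j ↦ j.elim0) ?_ (fun j ↦ j.elim0))
  · show supCkENorm _ 0 (Minkowski.spacetime.deviationExtend (Minkowski.backgroundOn ⊤) ReversedModel.Φ) ≤ 10⁻¹
    rw [ReversedModel.deviationExtend_Φ, supCkENorm_zero]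
    exact zero_le
  · intro τ' _ x hx
    have hc : IsClosed {x : E4 | x 0 ≤ -τ'} :=
      isClosed_le (PiLp.continuous_apply 2 _ 0) continuous_const
    have hx' : x ∈ closure (ReversedModel.Φ '' {y : (⊤ : Opens E4) | τ' ≤ y.1 0} : Set E4) := hx
    rw [ReversedModel.image_Φ_ge, hc.closure_eq] at hx'
    left
    have : x ∈ (ReversedModel.Φ '' {y : (⊤ : Opens E4) | τ' ≤ y.1 0} : Set E4) := by
      rw [ReversedModel.image_Φ_ge]; exact hx'
    exact this

end Summit.FinalStateConjecture.FinalStateConjecture.Theorems.SeamedChartsExhaust.Negative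

end
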